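/-
Copyright: derived here (Resolution Observatory cell `pub-rosobs`, carver gen 55). AI-written Lean; AI review is
weaker than expert review.  Companion file of the cell's POLYNOMIAL weighted-centre model `W(f)`: the pure-algebra
core of engine 1's LEMMA VE "V-elimination" (THEOREM-L5N-eng1-g36 §12 W1; CARVER-NOTES-eng1-g36 T44).
Instrument — NOT a resolution theorem and NOT a statement about the invariant of [AbramovichTemkinWlodarczyk2024].
-/
import Mathlib.Algebra.MvPolynomial.CommRing
import Mathlib.RingTheory.MvPolynomial.Homogeneous
import Mathlib.LinearAlgebra.Matrix.NonsingularInverse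
import Mathlib.Tactic.LinearCombination
import Mathlib.Tactic.Ring
import Mathlib.Tactic.Abel
import HarnessLib

/-!
# V-elimination: completing the square removes the weight-`1/2` slots (CARVER task T44)

INSTRUMENT, NOT a resolution theorem: the pure-algebra core of LEMMA VE (THEOREM-L5N eng1-g36 §12 W1)
of ENGINE 1's polynomial weighted-centre TOY MODEL `W(f)`.

Setting (CARVER-NOTES T44, slightly generalised).  `R` is a commutative ring (in the model `R = K[y]`, the
polynomial ring of the slots of weight `≠ 1/2`), `x = (x_i)_{i ∈ ι}` are the `V`-variables (the slots of
weight `1/2`), and we work in `R[x] = MvPolynomial ι R`.  `Q : Matrix ι ι R` is a symmetric matrix (the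
`VV`-part, the quadratic form `Q(x) = xᵀ Q x`), `L : ι → R` (`L ∈ K[y]^a`), `H : R`; the `V`-face is

  `G = Q(x) + x·L + H`   (`face Q L H`).

An endomorphism `Ψ` of `R[x]` "whose shifts do not involve `x`" is a ring endomorphism with
`Ψ(x_i) = x_i + A_i` (`A_i ∈ R`) acting on coefficients through a ring endomorphism `τ` of `R`
(`Ψ(C r) = C(τ r)`; in the model `τ : y ↦ y + B(y)`) that fixes the entries of `Q` (constants of `K`).

* `map_face`: `Ψ G = Q(x) + x·(2 Q A + τL) + (Aᵀ Q A + A·τL + τH)` — the parts of `x`-degree `2 / 1 / 0`.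
* `face_invariant_iff` (**W1, primitive form**, any commutative `R`): `Ψ G = G` iff
  `2 Q A + τL = L` (compare the parts of `x`-degree `1`) and `Aᵀ Q A + A·τL + τH = H` (degree `0`).
* `shift_eq_of_invariant` (**W1 (i)**; `2` and `det Q` units, i.e. `rad B_Q = 0`): `A = −½ Q⁻¹ (τL − L)`
  ("`A_V = −½ Q⁻¹ ΔL`": the `V`-component of the isotropy is determined by the other components).
* `schurFace_invariant_of_invariant` (**W1 (ii)**): with `G′ := H − ¼ Lᵀ Q⁻¹ L` (`schurFace`),
  `τ G′ = G′` ("`G′(y + B) = G′(y)`"); and `face_invariant_iff_schur`: `Ψ G = G` iff (i) ∧ (ii) —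
  the `V`-free part of the isotropy equation is EXACTLY the isotropy equation of `G′`.
* `completeSquare_face` (**W1 (ii)/(iii), completing the square**): the substitution
  `φ : x_i ↦ x_i − ½ (Q⁻¹ L)_i` (identity on `R`) gives `G ∘ φ = Q(x) + G′`.
* `completeSquare_comp_eq` (the conjugate isotropy): if `Ψ G = G` then `φ ∘ Ψ = (map τ) ∘ φ` as ring
  endomorphisms of `R[x]` — the conjugate isotropy acts by `τ` on `R` and FIXES every `x_i`.
* `shift_eq_zero_of_invariant`, `eq_id_of_invariant`: if `τ` fixes `L` (resp. `τ = id`) then `A = 0`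
  (resp. `Ψ = id`) — "`Ψ̄|_{N∖V} ≠ id`, else `Ψ̄ = id`" of W1 (iii).

All of it is completing the square for a non-degenerate quadratic form with `2` invertible
[Serre1973, Ch. IV §1]; bookkeeping only; NOT a statement about the Abramovich–Temkin–Włodarczyk invariant
[AbramovichTemkinWlodarczyk2024, §5.2] (context: coordinate changes preserving the centre); nothing here is
summit progress; AI-written, AI review weaker than expert review.
-/

namespace Literature.AlgebraicGeometry.Resolution.WeightedBlowup

namespace VElimination

open MvPolynomial Matrix

variable {R : Type*} [CommRing R] {ι : Type*} [Fintype ι]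

/-! ## The face `G = Q(x) + x·L + H` and its parts of `x`-degree `2`, `1`, `0` -/

/-- The vector of `x`-variables `(X_i)_{i ∈ ι}` of `R[x]`. [cite: Serre1973, Ch. IV §1 (quadratic forms)] -/
noncomputable def xvec : ι → MvPolynomial ι R := fun i => X i

/-- A vector of constants `(C u_i)_i` of `R[x]`. [cite: Serre1973, Ch. IV §1 (quadratic forms)] -/
noncomputable def cvec (u : ι → R) : ι → MvPolynomial ι R := fun i => C (u i)

omit [Fintype ι] in
/-- The vector of variables, componentwise (bookkeeping). [cite: Serre1973, Ch. IV §1 (quadratic forms)] -/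
@[simp] theorem xvec_apply (i : ι) : (xvec i : MvPolynomial ι R) = X i := rfl

omit [Fintype ι] in
/-- The constant vector, componentwise (bookkeeping). [cite: Serre1973, Ch. IV §1 (quadratic forms)] -/
@[simp] theorem cvec_apply (u : ι → R) (i : ι) : cvec u i = C (u i) := rfl

omit [Fintype ι] in
/-- `cvec` is additive (bookkeeping). [cite: Serre1973, Ch. IV §1 (quadratic forms)] -/
theorem cvec_add (u v : ι → R) : cvec (u + v) = cvec u + cvec v := by
  funext i
  simp

omit [Fintype ι] in
/-- `cvec 0 = 0` (bookkeeping). [cite: Serre1973, Ch. IV §1 (quadratic forms)] -/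
@[simp] theorem cvec_zero : cvec (0 : ι → R) = 0 := by
  funext i
  simp

/-- `(C u) · (C v) = C (u · v)`. [cite: Serre1973, Ch. IV §1 (quadratic forms)] -/
theorem cvec_dotProduct_cvec (u v : ι → R) : cvec u ⬝ᵥ cvec v = C (u ⬝ᵥ v) :=
  (RingHom.map_dotProduct C u v).symm

/-- `Q (C u) = C (Q u)`. [cite: Serre1973, Ch. IV §1 (quadratic forms)] -/
theorem map_mulVec_cvec (M : Matrix ι ι R) (u : ι → R) :
    M.map (C : R →+* MvPolynomial ι R) *ᵥ cvec u = cvec (M *ᵥ u) := by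
  funext i
  exact (RingHom.map_mulVec C M u i).symm

/-- The quadratic form `Q(x) = xᵀ Q x = Σ_{i,j} Q_{ij} x_i x_j` as a polynomial in the `x`-variables.
[cite: Serre1973, Ch. IV §1 (quadratic forms)] -/
noncomputable def quadPoly (Q : Matrix ι ι R) : MvPolynomial ι R :=
  (xvec : ι → MvPolynomial ι R) ⬝ᵥ (Q.map C *ᵥ xvec)

/-- The linear form `x · u = Σ_i x_i u_i` (`u_i ∈ R`). [cite: Serre1973, Ch. IV §1 (quadratic forms)] -/
noncomputable def linPoly (u : ι → R) : MvPolynomial ι R :=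
  (xvec : ι → MvPolynomial ι R) ⬝ᵥ cvec u

/-- The `V`-face `G = Q(x) + x·L + H` of LEMMA VE (W0).
[cite: AbramovichTemkinWlodarczyk2024, §5.2 (context only)] -/
noncomputable def face (Q : Matrix ι ι R) (L : ι → R) (H : R) : MvPolynomial ι R :=
  quadPoly Q + linPoly L + C H

/-- Unfolding the linear form `x·u = Σ x_i u_i` (bookkeeping). [cite: Serre1973, Ch. IV §1 (quadratic forms)] -/
theorem linPoly_apply (u : ι → R) : linPoly u = ∑ i, X i * C (u i) := rfl

/-- The linear form as a sum of degree-one monomials (bookkeeping). [cite: Serre1973, Ch. IV §1 (quadratic forms)] -/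
theorem linPoly_eq_sum_monomial (u : ι → R) :
    linPoly u = ∑ i, monomial (Finsupp.single i 1) (u i) := by
  rw [linPoly_apply]
  refine Finset.sum_congr rfl fun i _ => ?_
  rw [mul_comm, C_mul_X_eq_monomial]

/-- The linear form of `0` vanishes (bookkeeping). [cite: Serre1973, Ch. IV §1 (quadratic forms)] -/
@[simp] theorem linPoly_zero : linPoly (0 : ι → R) = 0 := by
  simp [linPoly_apply]

/-- The linear form is additive in `u` (bookkeeping). [cite: Serre1973, Ch. IV §1 (quadratic forms)] -/
theorem linPoly_add (u v : ι → R) : linPoly (u + v) = linPoly u + linPoly v := by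
  simp only [linPoly_apply, Pi.add_apply, map_add, mul_add, Finset.sum_add_distrib]

/-- Unfolding the quadratic form `Q(x) = Σ_i x_i Σ_j Q_{ij} x_j` (bookkeeping). [cite: Serre1973, Ch. IV §1 (quadratic forms)] -/
theorem quadPoly_apply (Q : Matrix ι ι R) :
    quadPoly Q = ∑ i, X i * ∑ j, C (Q i j) * X j := by
  simp [quadPoly, dotProduct, mulVec, Matrix.map_apply]

/-- `x · u` is homogeneous of degree `1` in `x`. [cite: Serre1973, Ch. IV §1 (quadratic forms)] -/
theorem isHomogeneous_linPoly (u : ι → R) : (linPoly u).IsHomogeneous 1 := by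
  rw [linPoly_apply]
  refine IsHomogeneous.sum _ _ 1 fun i _ => ?_
  simpa using (isHomogeneous_X R i).mul (isHomogeneous_C ι (u i))

/-- `Q(x)` is homogeneous of degree `2` in `x`. [cite: Serre1973, Ch. IV §1 (quadratic forms)] -/
theorem isHomogeneous_quadPoly (Q : Matrix ι ι R) : (quadPoly Q).IsHomogeneous 2 := by
  rw [quadPoly_apply]
  refine IsHomogeneous.sum _ _ 2 fun i _ => ?_
  have h1 : (∑ j, C (Q i j) * X j : MvPolynomial ι R).IsHomogeneous 1 :=
    IsHomogeneous.sum _ _ 1 fun j _ => isHomogeneous_C_mul_X _ _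
  simpa using (isHomogeneous_X R i).mul h1

/-- The coefficient of `x_k` in `x · u` is `u_k`. [cite: Serre1973, Ch. IV §1 (quadratic forms)] -/
theorem coeff_single_linPoly [DecidableEq ι] (u : ι → R) (k : ι) :
    coeff (Finsupp.single k 1) (linPoly u) = u k := by
  rw [linPoly_eq_sum_monomial, coeff_sum]
  simp only [coeff_monomial, Finsupp.single_left_inj one_ne_zero]
  simp

/-- The linear form has no constant term (bookkeeping). [cite: Serre1973, Ch. IV §1 (quadratic forms)] -/
theorem coeff_zero_linPoly (u : ι → R) : coeff 0 (linPoly u) = 0 :=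
  (isHomogeneous_linPoly u).coeff_eq_zero (by simp)

/-- The quadratic form has no `x`-degree-one terms (bookkeeping). [cite: Serre1973, Ch. IV §1 (quadratic forms)] -/
theorem coeff_single_quadPoly (Q : Matrix ι ι R) (k : ι) :
    coeff (Finsupp.single k 1) (quadPoly Q) = 0 :=
  (isHomogeneous_quadPoly Q).coeff_eq_zero (by simp)

/-- The quadratic form has no constant term (bookkeeping). [cite: Serre1973, Ch. IV §1 (quadratic forms)] -/
theorem coeff_zero_quadPoly (Q : Matrix ι ι R) : coeff 0 (quadPoly Q) = 0 :=
  (isHomogeneous_quadPoly Q).coeff_eq_zero (by simp)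

/-- **Comparing the parts of `x`-degree `1` and `0`.**  `Q(x) + x·L + H = Q(x) + x·L′ + H′` iff
`L = L′` and `H = H′`. [cite: Serre1973, Ch. IV §1 (quadratic forms)] -/
theorem face_eq_face_iff (Q : Matrix ι ι R) {L L' : ι → R} {H H' : R} :
    face Q L H = face Q L' H' ↔ L = L' ∧ H = H' := by
  classical
  constructor
  · intro h
    have h' : linPoly L + C H = linPoly L' + C H' := by
      have h2 := h
      simp only [face, add_assoc] at h2
      exact add_left_cancel h2
    have hne : ∀ k : ι, (0 : ι →₀ ℕ) ≠ Finsupp.single k 1 := fun k =>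
      (Finsupp.single_ne_zero.mpr one_ne_zero).symm
    refine ⟨funext fun k => ?_, ?_⟩
    · have hk := congrArg (coeff (Finsupp.single k 1)) h'
      simpa [coeff_single_linPoly, coeff_C, hne k] using hk
    · have h0 := congrArg (coeff 0) h'
      simpa [coeff_zero_linPoly] using h0
  · rintro ⟨rfl, rfl⟩
    rfl

/-! ## The isotropy equation of the face, split by `x`-degree (W1) -/

section Isotropy

variable (Ψ : MvPolynomial ι R →+* MvPolynomial ι R) (τ : R →+* R) (A : ι → R)
  {Q : Matrix ι ι R}

/-- **Expansion.**  If `Ψ(C r) = C(τ r)`, `Ψ(x_i) = x_i + A_i`, `Q` is symmetric and `τ` fixes its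
entries, then `Ψ(Q(x) + x·L + H) = Q(x) + x·(2 Q A + τL) + (Aᵀ Q A + A·τL + τH)`.
[cite: Serre1973, Ch. IV §1 (quadratic forms)] -/
theorem map_face (hC : ∀ r, Ψ (C r) = C (τ r)) (hX : ∀ i, Ψ (X i) = X i + C (A i))
    (hQ : Q.IsSymm) (hτQ : ∀ i j, τ (Q i j) = Q i j) (L : ι → R) (H : R) :
    Ψ (face Q L H) =
      face Q (fun i => 2 * (Q *ᵥ A) i + τ (L i)) (A ⬝ᵥ Q *ᵥ A + A ⬝ᵥ (τ ∘ L) + τ H) := by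
  have hΨx : (Ψ ∘ (xvec : ι → MvPolynomial ι R)) = xvec + cvec A := by
    funext i
    simp [hX i]
  have hΨc : ∀ u : ι → R, (Ψ ∘ cvec u) = cvec (τ ∘ u) := by
    intro u
    funext i
    simp [hC]
  have hQC : (Q.map (C : R →+* MvPolynomial ι R)).map Ψ = Q.map C := by
    ext i j
    simp only [Matrix.map_apply, hC, hτQ]
  have hsymmC : (Q.map (C : R →+* MvPolynomial ι R))ᵀ = Q.map C := by
    rw [← transpose_map, hQ.eq]
  -- the quadratic part
  have hquad : Ψ (quadPoly Q) =
      quadPoly Q + (linPoly (Q *ᵥ A) + linPoly (Q *ᵥ A)) + C (A ⬝ᵥ Q *ᵥ A) := by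
    unfold quadPoly
    rw [RingHom.map_dotProduct]
    have hmv : (Ψ ∘ (Q.map C *ᵥ (xvec : ι → MvPolynomial ι R))) = Q.map C *ᵥ (Ψ ∘ xvec) := by
      funext i
      simp only [Function.comp_apply]
      rw [RingHom.map_mulVec, hQC]
    rw [hmv, hΨx, mulVec_add, add_dotProduct, dotProduct_add, dotProduct_add]
    have cross : cvec A ⬝ᵥ (Q.map C *ᵥ (xvec : ι → MvPolynomial ι R)) =
        xvec ⬝ᵥ (Q.map C *ᵥ cvec A) := by
      rw [dotProduct_mulVec, ← mulVec_transpose, hsymmC, dotProduct_comm]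
    rw [cross, map_mulVec_cvec, cvec_dotProduct_cvec]
    unfold linPoly
    abel
  -- the linear part
  have hlin : Ψ (linPoly L) = linPoly (τ ∘ L) + C (A ⬝ᵥ (τ ∘ L)) := by
    unfold linPoly
    rw [RingHom.map_dotProduct, hΨx, hΨc, add_dotProduct, cvec_dotProduct_cvec]
  -- assemble
  have hL₁ : linPoly (fun i => 2 * (Q *ᵥ A) i + τ (L i)) =
      linPoly (Q *ᵥ A) + linPoly (Q *ᵥ A) + linPoly (τ ∘ L) := by
    rw [← linPoly_add, ← linPoly_add]
    congr 1
    funext i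
    simp only [Pi.add_apply, Function.comp_apply, two_mul]
  unfold face
  rw [map_add, map_add, hquad, hlin, hC, hL₁, map_add C, map_add C]
  abel

/-- **LEMMA VE, W1 (primitive form, any commutative `R`).**  `Ψ G = G` iff the parts of `x`-degree `1`
and `0` agree: `2 (Q A)_i + τ L_i = L_i` for every `i`, and `Aᵀ Q A + A·τL + τH = H`.
[cite: Serre1973, Ch. IV §1 (quadratic forms)] -/
theorem face_invariant_iff (hC : ∀ r, Ψ (C r) = C (τ r)) (hX : ∀ i, Ψ (X i) = X i + C (A i))
    (hQ : Q.IsSymm) (hτQ : ∀ i j, τ (Q i j) = Q i j) (L : ι → R) (H : R) :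
    Ψ (face Q L H) = face Q L H ↔
      (∀ i, 2 * (Q *ᵥ A) i + τ (L i) = L i) ∧ A ⬝ᵥ Q *ᵥ A + A ⬝ᵥ (τ ∘ L) + τ H = H := by
  rw [map_face Ψ τ A hC hX hQ hτQ L H, face_eq_face_iff, funext_iff]

variable [DecidableEq ι]

/-- A ring endomorphism fixing the entries of a matrix with unit determinant fixes the entries of its
inverse. [cite: Serre1973, Ch. IV §1 (quadratic forms)] -/
theorem map_nonsing_inv_eq (hτQ : ∀ i j, τ (Q i j) = Q i j) (hdet : IsUnit Q.det) :
    Q⁻¹.map τ = Q⁻¹ := by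
  have hQτ : Q.map τ = Q := by
    ext i j
    exact hτQ i j
  have h1 : Q⁻¹.map τ * Q = 1 := by
    calc Q⁻¹.map τ * Q = Q⁻¹.map τ * Q.map τ := by rw [hQτ]
      _ = (Q⁻¹ * Q).map τ := Matrix.map_mul.symm
      _ = 1 := by rw [nonsing_inv_mul Q hdet, Matrix.map_one _ (map_zero τ) (map_one τ)]
  exact (inv_eq_left_inv h1).symm

/-- **LEMMA VE, W1 (i).**  If `Ψ G = G` and `2`, `det Q` are units of `R` (`rad B_Q = 0`), then
`A = −½ Q⁻¹ (τL − L)`: the `V`-component of the isotropy is determined by the other components.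
[cite: Serre1973, Ch. IV §1 (quadratic forms)] -/
theorem shift_eq_of_invariant [Invertible (2 : R)] (hC : ∀ r, Ψ (C r) = C (τ r))
    (hX : ∀ i, Ψ (X i) = X i + C (A i)) (hQ : Q.IsSymm) (hτQ : ∀ i j, τ (Q i j) = Q i j)
    (hdet : IsUnit Q.det) {L : ι → R} {H : R} (h : Ψ (face Q L H) = face Q L H) :
    A = -(⅟(2 : R) • (Q⁻¹ *ᵥ (τ ∘ L - L))) := by
  obtain ⟨hlin, -⟩ := (face_invariant_iff Ψ τ A hC hX hQ hτQ L H).1 h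
  have hQA : Q *ᵥ A = ⅟(2 : R) • (-(τ ∘ L - L)) := by
    funext i
    have hi := hlin i
    simp only [Pi.smul_apply, Pi.neg_apply, Pi.sub_apply, Function.comp_apply, smul_eq_mul]
    have h2 : (Q *ᵥ A) i = ⅟(2 : R) * (2 * (Q *ᵥ A) i) := by
      rw [← mul_assoc, invOf_mul_self, one_mul]
    rw [h2]
    congr 1
    linear_combination hi
  have hA : A = Q⁻¹ *ᵥ (Q *ᵥ A) := by
    rw [mulVec_mulVec, nonsing_inv_mul Q hdet, one_mulVec]
  rw [hA, hQA, mulVec_smul, mulVec_neg, smul_neg]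

/-- If `τ` fixes `L` (no shift of the weight-`1/2` coefficient vector) and `Ψ G = G`, then `A = 0`.
[cite: Serre1973, Ch. IV §1 (quadratic forms)] -/
theorem shift_eq_zero_of_invariant [Invertible (2 : R)] (hC : ∀ r, Ψ (C r) = C (τ r))
    (hX : ∀ i, Ψ (X i) = X i + C (A i)) (hQ : Q.IsSymm) (hτQ : ∀ i j, τ (Q i j) = Q i j)
    (hdet : IsUnit Q.det) {L : ι → R} {H : R} (hτL : ∀ i, τ (L i) = L i)
    (h : Ψ (face Q L H) = face Q L H) : A = 0 := by
  rw [shift_eq_of_invariant Ψ τ A hC hX hQ hτQ hdet h]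
  have h0 : τ ∘ L - L = 0 := by
    funext i
    simp [hτL i]
  rw [h0, mulVec_zero, smul_zero, neg_zero]

omit [DecidableEq ι] in
/-- "`Ψ̄|_{N∖V} ≠ id`, else `Ψ̄ = id`" (W1 (iii)): if `Ψ` is the identity on `R` and `Ψ G = G`, then
`Ψ = id`. [cite: Serre1973, Ch. IV §1 (quadratic forms)] -/
theorem eq_id_of_invariant [DecidableEq ι] [Invertible (2 : R)] (hC : ∀ r, Ψ (C r) = C r)
    (hX : ∀ i, Ψ (X i) = X i + C (A i)) (hQ : Q.IsSymm) (hdet : IsUnit Q.det) {L : ι → R}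
    {H : R} (h : Ψ (face Q L H) = face Q L H) : Ψ = RingHom.id _ := by
  have hA : A = 0 :=
    shift_eq_zero_of_invariant Ψ (RingHom.id R) A hC hX hQ (fun _ _ => rfl) hdet (fun _ => rfl) h
  refine ringHom_ext (fun r => by simp [hC]) (fun i => ?_)
  simp [hX i, hA]

/-! ## Completing the square: `G′ = H − ¼ Lᵀ Q⁻¹ L` (W1 (ii), (iii)) -/

/-- The completed-square constant term `G′ := H − ¼ Lᵀ Q⁻¹ L` (W1 (ii); in the model the `V`-free face
`G|_{ε_V = 0} − ¼ LᵀQ⁻¹L`). [cite: Serre1973, Ch. IV §1 (quadratic forms)] -/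
noncomputable def schurFace [Invertible (2 : R)] (Q : Matrix ι ι R) (L : ι → R) (H : R) : R :=
  H - ⅟(2 : R) * ⅟(2 : R) * (L ⬝ᵥ Q⁻¹ *ᵥ L)

omit [DecidableEq ι] in
/-- Moving a symmetric matrix across the dot product. [cite: Serre1973, Ch. IV §1 (quadratic forms)] -/
theorem mulVec_dotProduct_of_isSymm (hQ : Q.IsSymm) (v w : ι → R) :
    (Q *ᵥ v) ⬝ᵥ w = v ⬝ᵥ (Q *ᵥ w) := by
  rw [← vecMul_transpose, hQ.eq, ← dotProduct_mulVec]

/-- The Schur-complement identity behind W1 (ii): if `2 Q A + τL = L` then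
`(τL)ᵀ Q⁻¹ (τL) − Lᵀ Q⁻¹ L = 4 Aᵀ Q A − 4 A·L`. [cite: Serre1973, Ch. IV §1 (quadratic forms)] -/
theorem schur_difference_eq (hQ : Q.IsSymm) (hdet : IsUnit Q.det) {L : ι → R}
    (hlin : ∀ i, 2 * (Q *ᵥ A) i + τ (L i) = L i) :
    (τ ∘ L) ⬝ᵥ Q⁻¹ *ᵥ (τ ∘ L) - L ⬝ᵥ Q⁻¹ *ᵥ L = 4 * (A ⬝ᵥ Q *ᵥ A) - 4 * (A ⬝ᵥ L) := by
  have hτL : τ ∘ L = L - (2 : R) • (Q *ᵥ A) := by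
    funext i
    simp only [Function.comp_apply, Pi.sub_apply, Pi.smul_apply, smul_eq_mul]
    linear_combination hlin i
  have h1 : Q⁻¹ *ᵥ (Q *ᵥ A) = A := by
    rw [mulVec_mulVec, nonsing_inv_mul Q hdet, one_mulVec]
  have h2 : (Q *ᵥ A) ⬝ᵥ (Q⁻¹ *ᵥ L) = A ⬝ᵥ L := by
    rw [mulVec_dotProduct_of_isSymm hQ, mulVec_mulVec, mul_nonsing_inv Q hdet, one_mulVec]
  have h3 : (Q *ᵥ A) ⬝ᵥ A = A ⬝ᵥ Q *ᵥ A := dotProduct_comm _ _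
  have h4 : L ⬝ᵥ A = A ⬝ᵥ L := dotProduct_comm _ _
  rw [hτL, mulVec_sub, mulVec_smul, h1, sub_dotProduct, dotProduct_sub, dotProduct_sub,
    smul_dotProduct, smul_dotProduct, dotProduct_smul, dotProduct_smul, h2, h3, h4]
  simp only [smul_eq_mul]
  ring

/-- `(½)·(½)·4 = 1` when `2` is invertible (bookkeeping). [cite: Serre1973, Ch. IV §1 (quadratic forms)] -/
theorem invOf_two_mul_invOf_two_mul_four [Invertible (2 : R)] : ⅟(2 : R) * ⅟(2 : R) * 4 = 1 := by
  calc ⅟(2 : R) * ⅟(2 : R) * 4 = (⅟(2 : R) * 2) * (⅟(2 : R) * 2) := by ring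
    _ = 1 := by rw [invOf_mul_self, one_mul]

/-- Under `2 Q A + τL = L`, the `x`-degree-`0` identity `Aᵀ Q A + A·τL + τH = H` is equivalent to
`4 (τH − H) = (τL)ᵀQ⁻¹(τL) − LᵀQ⁻¹L` (`2` a unit). [cite: Serre1973, Ch. IV §1 (quadratic forms)] -/
theorem const_iff_four_mul [Invertible (2 : R)] (hQ : Q.IsSymm) (hdet : IsUnit Q.det) {L : ι → R}
    (H : R) (hlin : ∀ i, 2 * (Q *ᵥ A) i + τ (L i) = L i) :
    A ⬝ᵥ Q *ᵥ A + A ⬝ᵥ (τ ∘ L) + τ H = H ↔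
      4 * (τ H - H) = (τ ∘ L) ⬝ᵥ Q⁻¹ *ᵥ (τ ∘ L) - L ⬝ᵥ Q⁻¹ *ᵥ L := by
  rw [schur_difference_eq τ A hQ hdet hlin]
  have hτL : τ ∘ L = L - (2 : R) • (Q *ᵥ A) := by
    funext i
    simp only [Function.comp_apply, Pi.sub_apply, Pi.smul_apply, smul_eq_mul]
    linear_combination hlin i
  have hAτL : A ⬝ᵥ (τ ∘ L) = A ⬝ᵥ L - 2 * (A ⬝ᵥ Q *ᵥ A) := by
    rw [hτL, dotProduct_sub, dotProduct_smul, smul_eq_mul]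
  rw [hAτL]
  have e := invOf_two_mul_invOf_two_mul_four (R := R)
  constructor
  · intro h
    linear_combination 4 * h
  · intro h
    linear_combination (⅟(2 : R) * ⅟(2 : R)) * h -
      (τ H - H - A ⬝ᵥ Q *ᵥ A + A ⬝ᵥ L) * e

/-- A ring endomorphism fixes `⅟2`. [cite: Serre1973, Ch. IV §1 (quadratic forms)] -/
theorem map_invOf_two [Invertible (2 : R)] : τ (⅟(2 : R)) = ⅟(2 : R) := by
  have h : τ (⅟(2 : R)) * 2 = 1 := by
    have h1 := congrArg τ (invOf_mul_self (2 : R))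
    rwa [map_mul, map_ofNat, map_one] at h1
  calc τ (⅟(2 : R)) = τ (⅟(2 : R)) * (2 * ⅟(2 : R)) := by rw [mul_invOf_self, mul_one]
    _ = ⅟(2 : R) := by rw [← mul_assoc, h, one_mul]

/-- `τ(G′) = τH − ¼ (τL)ᵀ Q⁻¹ (τL)` when `τ` fixes the entries of `Q`.
[cite: Serre1973, Ch. IV §1 (quadratic forms)] -/
theorem map_schurFace [Invertible (2 : R)] (hτQ : ∀ i j, τ (Q i j) = Q i j) (hdet : IsUnit Q.det)
    (L : ι → R) (H : R) :
    τ (schurFace Q L H) = τ H - ⅟(2 : R) * ⅟(2 : R) * ((τ ∘ L) ⬝ᵥ Q⁻¹ *ᵥ (τ ∘ L)) := by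
  have hS : τ (L ⬝ᵥ Q⁻¹ *ᵥ L) = (τ ∘ L) ⬝ᵥ Q⁻¹ *ᵥ (τ ∘ L) := by
    rw [RingHom.map_dotProduct]
    congr 1
    funext i
    simp only [Function.comp_apply]
    rw [RingHom.map_mulVec, map_nonsing_inv_eq τ hτQ hdet]
  simp only [schurFace, map_sub, map_mul, map_invOf_two τ, hS]

/-- **LEMMA VE, W1 (ii).**  If `Ψ G = G` (`2`, `det Q` units) then `G′ := H − ¼ LᵀQ⁻¹L` satisfies
`τ G′ = G′` ("`G′(y + B) = G′(y)`"). [cite: Serre1973, Ch. IV §1 (quadratic forms)] -/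
theorem schurFace_invariant_of_invariant [Invertible (2 : R)] (hC : ∀ r, Ψ (C r) = C (τ r))
    (hX : ∀ i, Ψ (X i) = X i + C (A i)) (hQ : Q.IsSymm) (hτQ : ∀ i j, τ (Q i j) = Q i j)
    (hdet : IsUnit Q.det) {L : ι → R} {H : R} (h : Ψ (face Q L H) = face Q L H) :
    τ (schurFace Q L H) = schurFace Q L H := by
  obtain ⟨hlin, hconst⟩ := (face_invariant_iff Ψ τ A hC hX hQ hτQ L H).1 h
  have h4 := (const_iff_four_mul τ A hQ hdet H hlin).1 hconst
  have e := invOf_two_mul_invOf_two_mul_four (R := R)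
  rw [map_schurFace τ hτQ hdet, schurFace]
  linear_combination (⅟(2 : R) * ⅟(2 : R)) * h4 - (τ H - H) * e

/-- **LEMMA VE, W1: the `V`-free part of the isotropy equation is EXACTLY the isotropy equation of `G′`.**
`Ψ G = G` iff `A = −½ Q⁻¹(τL − L)` and `τ G′ = G′` (`2`, `det Q` units).
[cite: Serre1973, Ch. IV §1 (quadratic forms)] -/
theorem face_invariant_iff_schur [Invertible (2 : R)] (hC : ∀ r, Ψ (C r) = C (τ r))
    (hX : ∀ i, Ψ (X i) = X i + C (A i)) (hQ : Q.IsSymm) (hτQ : ∀ i j, τ (Q i j) = Q i j)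
    (hdet : IsUnit Q.det) (L : ι → R) (H : R) :
    Ψ (face Q L H) = face Q L H ↔
      A = -(⅟(2 : R) • (Q⁻¹ *ᵥ (τ ∘ L - L))) ∧ τ (schurFace Q L H) = schurFace Q L H := by
  constructor
  · intro h
    exact ⟨shift_eq_of_invariant Ψ τ A hC hX hQ hτQ hdet h,
      schurFace_invariant_of_invariant Ψ τ A hC hX hQ hτQ hdet h⟩
  · rintro ⟨hA, hS⟩
    rw [face_invariant_iff Ψ τ A hC hX hQ hτQ L H]
    have hQA : Q *ᵥ A = -(⅟(2 : R) • (τ ∘ L - L)) := by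
      rw [hA, mulVec_neg, mulVec_smul, mulVec_mulVec, mul_nonsing_inv Q hdet, one_mulVec]
    have e2 : (2 : R) * ⅟(2 : R) = 1 := mul_invOf_self _
    have hlin : ∀ i, 2 * (Q *ᵥ A) i + τ (L i) = L i := by
      intro i
      have hi := congrFun hQA i
      simp only [Pi.neg_apply, Pi.smul_apply, Pi.sub_apply, Function.comp_apply, smul_eq_mul] at hi
      rw [hi]
      linear_combination (-(τ (L i) - L i)) * e2
    refine ⟨hlin, ?_⟩
    rw [const_iff_four_mul τ A hQ hdet H hlin]
    rw [map_schurFace τ hτQ hdet, schurFace] at hS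
    have e := invOf_two_mul_invOf_two_mul_four (R := R)
    linear_combination 4 * hS + ((τ ∘ L) ⬝ᵥ Q⁻¹ *ᵥ (τ ∘ L) - L ⬝ᵥ Q⁻¹ *ᵥ L) * e

/-- The completing-the-square substitution `φ : x_i ↦ x_i − ½ (Q⁻¹ L)_i`, identity on `R`
(a triangular, weight-preserving change of the `V`-variables). [cite: Serre1973, Ch. IV §1 (quadratic forms)] -/
noncomputable def completeSquare [Invertible (2 : R)] (Q : Matrix ι ι R) (L : ι → R) :
    MvPolynomial ι R →+* MvPolynomial ι R :=
  eval₂Hom C fun i => X i - C ((⅟(2 : R) • (Q⁻¹ *ᵥ L)) i)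

/-- Completing the square is the identity on coefficients (bookkeeping). [cite: Serre1973, Ch. IV §1 (quadratic forms)] -/
@[simp] theorem completeSquare_C [Invertible (2 : R)] (Q : Matrix ι ι R) (L : ι → R) (r : R) :
    completeSquare Q L (C r) = C r :=
  eval₂Hom_C _ _ r

/-- Completing the square on a variable: `x_i ↦ x_i − ½ (Q⁻¹ L)_i` (bookkeeping). [cite: Serre1973, Ch. IV §1 (quadratic forms)] -/
@[simp] theorem completeSquare_X [Invertible (2 : R)] (Q : Matrix ι ι R) (L : ι → R) (i : ι) :
    completeSquare Q L (X i) = X i - C ((⅟(2 : R) • (Q⁻¹ *ᵥ L)) i) :=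
  eval₂Hom_X' _ _ i

/-- **LEMMA VE, W1 (ii)/(iii): completing the square.**  `G ∘ φ = Q(x) + G′` for
`φ : x ↦ x − ½ Q⁻¹ L` (`Q` symmetric, `2` and `det Q` units). [cite: Serre1973, Ch. IV §1 (quadratic forms)] -/
theorem completeSquare_face [Invertible (2 : R)] (hQ : Q.IsSymm) (hdet : IsUnit Q.det) (L : ι → R)
    (H : R) : completeSquare Q L (face Q L H) = quadPoly Q + C (schurFace Q L H) := by
  set c : ι → R := ⅟(2 : R) • (Q⁻¹ *ᵥ L) with hc
  have hC' : ∀ r, completeSquare Q L (C r) = C ((RingHom.id R) r) := fun r => by simp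
  have hX' : ∀ i, completeSquare Q L (X i) = X i + C ((-c) i) := fun i => by
    simp [hc, sub_eq_add_neg]
  have key := map_face (completeSquare Q L) (RingHom.id R) (-c) hC' hX' hQ (fun _ _ => rfl) L H
  rw [key, show quadPoly Q + C (schurFace Q L H) = face Q 0 (schurFace Q L H) by simp [face],
    face_eq_face_iff]
  have hQc : Q *ᵥ c = ⅟(2 : R) • L := by
    rw [hc, mulVec_smul, mulVec_mulVec, mul_nonsing_inv Q hdet, one_mulVec]
  have e2 : (2 : R) * ⅟(2 : R) = 1 := mul_invOf_self _
  refine ⟨?_, ?_⟩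
  · funext i
    have hi := congrFun hQc i
    simp only [Pi.smul_apply, smul_eq_mul] at hi
    simp only [mulVec_neg, Pi.neg_apply, RingHom.id_apply, Pi.zero_apply, hi]
    linear_combination (-(L i)) * e2
  · have hcL : c ⬝ᵥ L = ⅟(2 : R) * (L ⬝ᵥ Q⁻¹ *ᵥ L) := by
      rw [hc, smul_dotProduct, smul_eq_mul, dotProduct_comm]
    have hcQc : c ⬝ᵥ Q *ᵥ c = ⅟(2 : R) * (c ⬝ᵥ L) := by
      rw [hQc, dotProduct_smul, smul_eq_mul]
    simp only [mulVec_neg, neg_dotProduct, dotProduct_neg, neg_neg, RingHom.coe_id,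
      Function.id_comp, RingHom.id_apply, hcQc, hcL, schurFace]
    linear_combination (⅟(2 : R) * (L ⬝ᵥ Q⁻¹ *ᵥ L)) * e2

/-- **The conjugate isotropy fixes the `V`-variables.**  If `Ψ G = G` then `φ ∘ Ψ = (map τ) ∘ φ` as
ring endomorphisms of `R[x]`, i.e. `φ Ψ φ⁻¹` acts by `τ` on the coefficients and fixes every `x_i`
(W1 (ii): "the conjugate isotropy equals `Ψ̄` on `N ∖ V` and FIXES every `ε_v`").
[cite: Serre1973, Ch. IV §1 (quadratic forms)] -/
theorem completeSquare_comp_eq [Invertible (2 : R)] (hC : ∀ r, Ψ (C r) = C (τ r))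
    (hX : ∀ i, Ψ (X i) = X i + C (A i)) (hQ : Q.IsSymm) (hτQ : ∀ i j, τ (Q i j) = Q i j)
    (hdet : IsUnit Q.det) {L : ι → R} {H : R} (h : Ψ (face Q L H) = face Q L H) :
    (completeSquare Q L).comp Ψ = (map τ).comp (completeSquare Q L) := by
  have hA := shift_eq_of_invariant Ψ τ A hC hX hQ hτQ hdet h
  refine ringHom_ext (fun r => ?_) (fun i => ?_)
  · simp [hC, map_C]
  · have hτq : τ ((⅟(2 : R) • (Q⁻¹ *ᵥ L)) i) = (⅟(2 : R) • (Q⁻¹ *ᵥ (τ ∘ L))) i := by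
      simp only [Pi.smul_apply, smul_eq_mul, map_mul, map_invOf_two τ]
      rw [RingHom.map_mulVec, map_nonsing_inv_eq τ hτQ hdet]
    have hAi : A i = (⅟(2 : R) • (Q⁻¹ *ᵥ L)) i - (⅟(2 : R) • (Q⁻¹ *ᵥ (τ ∘ L))) i := by
      rw [hA]
      simp only [Pi.neg_apply, Pi.smul_apply, smul_eq_mul, mulVec_sub, Pi.sub_apply]
      ring
    simp only [RingHom.coe_comp, Function.comp_apply, hX i, map_add, map_sub, completeSquare_X,
      completeSquare_C, map_X, map_C, hτq, hAi, map_sub C]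
    ring

end Isotropy

end VElimination

end Literature.AlgebraicGeometry.Resolution.WeightedBlowup
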